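import Literature.AlgebraicGeometry.HodgeTheory.IntegralLefschetzOneOneIdeal
import Summits.HodgeConjecture.HodgeConjecture.Theses.GenericDivisibility

/-!
# Route GenericDivisibility — crux `HodgeClassesGenericallyDivisible` (C1, item stmt-HodgeConjecture-18466):
# the DIVISOR-IDEAL sector, unconditionally, in every dimension `2p`

The companion `Theorems/GenericDivisibilityHodgeClassesGenericallyDivisibleIntegral` settled the
surface case `p = 1` of the crux outright, from the tree's INTEGRAL Lefschetz theorem on
`(1,1)`-classes in Zariski-local form (`integralLefschetzOneOne`).  This file draws the consequence in
every dimension: the coniveau-`1` integral classes `N¹ H^*(X(ℂ); ℤ) = coniveauFiltration ℤ X * 1`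
(classes dying on the complex points of a non-empty Zariski open) form a two-sided cup ideal containing
every integral `(1,1)`-class (`HodgeTheory/IntegralLefschetzOneOneIdeal`), so the crux C1 holds — with
`y = 0` — for every middle class in the ideal of `H^*(X(ℂ); ℤ)` generated by the integral
`(1,1)`-classes (sums of `D ⌣ w` and `w ⌣ D`, `D ∈ H²(X(ℂ); ℤ)` of `(1,1)` complexification — torsion
classes of degree `2` included — and `w` arbitrary), on every smooth projective `2p`-fold and for every
`m ≥ 1`; and for a class a MULTIPLE `N • z` of which lies in `N¹ H²ᵖ(X(ℂ); ℤ)` it holds at every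
modulus `m` prime to `N` (Bézout), the primes dividing `N` being exactly where the route's support item
`TorsionDiesGenerically` would be needed:

* `hodgeClassesGenericallyDivisible_of_mem_coniveauFiltration_int` — `z ∈ N¹ H²ᵖ(X(ℂ); ℤ)` ⇒ the
  conclusion of C1 for `z` at every `m` (with `y = 0`);
* `hodgeClassesGenericallyDivisible_of_nsmul_mem_coniveauFiltration_int` — `N • z ∈ N¹`, `m` prime
  to `N` ⇒ the conclusion of C1 for `z` at `m`;
* `hodgeClassesGenericallyDivisible_of_mem_span_cupProduct_oneOne` — **the divisor-ideal
  sector of C1**: `z` in the `ℤ`-span of the `D ⌣ w`, `w ⌣ D` ⇒ C1 for `z` at every `m`;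
* `stub_hodgeClassesGenericallyDivisible_divisorIdeal` — the registered sub-goal of the item of that
  name (the item's statement with the hypothesis "`z` in the divisor ideal" in place of "`z ⊗ ℂ` of
  type `(p,p)`", which it implies for honest Hodge classes but is not used).

The crux itself (all `(p,p)`-classes, `p ≥ 2`) is untouched: it is of Hodge-conjecture strength
(`Theorems/GenericDivisibilityHodgeClassesGenericallyDivisible`).

References: C. Voisin, *Hodge Theory and Complex Algebraic Geometry I* (2002), Thm. 11.30, Rem. 7.9,
Thm. 11.33 [VoisinHodgeI2002]; S. Bloch, A. Ogus, Ann. Sci. ÉNS 7 (1974), (3.8) [BlochOgus1974ENS];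
A. Hatcher, *Algebraic Topology* (2002), Prop. 3.10 [HatcherAT2002].
-/

-- `Summit.HodgeConjecture.HodgeConjecture.Theorems` is the mandated namespace (single-problem summit:
-- Problem = Summit), which `linter.dupNamespace` flags on every declaration; the lakefile turns the
-- linter off tree-wide (weak option), restated here so stand-alone elaboration is warning-free too.
set_option linter.dupNamespace false

noncomputable section

namespace Summit.HodgeConjecture.HodgeConjecture.Theorems

open Literature.AlgebraicGeometry.Motives Literature.AlgebraicGeometry.HodgeTheory
  Literature.AlgebraicTopology.SingularHomology
open Summit.HodgeConjecture.HodgeConjecture.Theses.GenericDivisibility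

/-- **C1 for coniveau-`1` integral classes.** If `z ∈ N¹ H²ᵖ(X(ℂ); ℤ)` — `z` dies on the complex
points of a non-empty Zariski open — then for every `m` there are a proper Zariski-closed `Z` and `y`
(namely `0`) on `(X ∖ Z)(ℂ)` with `m • y = z|_{(X ∖ Z)(ℂ)}`. [cite: BlochOgus1974ENS, (3.8)] -/
theorem hodgeClassesGenericallyDivisible_of_mem_coniveauFiltration_int
    ⦃p : ℕ⦄ ⦃X : SchemeOver ℂ⦄ (hX : IsSmoothProjective (2 * p) X)
    (z : singularCohomology ℤ ℤ (ComplexPoints X) (2 * p))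
    (hz : z ∈ coniveauFiltration ℤ X (2 * p) 1) (m : ℕ) :
    ∃ Z : Set X.left, IsClosed Z ∧ Z ≠ Set.univ ∧
      ∃ y : singularCohomology ℤ ℤ (complexPointsCompl X Z) (2 * p),
        m • y = singularCohomology.map ℤ ℤ
          (⟨Subtype.val, continuous_subtype_val⟩ : C(complexPointsCompl X Z, ComplexPoints X))
          (2 * p) z := by
  haveI := IsSmoothProjective.isIntegral_holds hX
  obtain ⟨Z, hZ, hZne, h0⟩ :=
    (exists_ne_univ_restrictToCompl_eq_zero_iff_mem_coniveauFiltration_one ℤ z).2 hz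
  exact ⟨Z, hZ, hZne, 0, by rw [smul_zero]; exact h0.symm⟩

/-- **C1 at moduli prime to `N` for classes with `N • z ∈ N¹ H²ᵖ(X(ℂ); ℤ)`.** If `N • z` dies on
`(X ∖ Z)(ℂ)`, `Z ≠ X` Zariski-closed, and `m` is prime to `N`, then `z|_{(X ∖ Z)(ℂ)} = m • y` with
`y = a • z|_{(X ∖ Z)(ℂ)}`, `m a ≡ 1 (mod N)` (Bézout): the restriction is `N`-torsion. The primes
dividing `N` are where a torsion class on a Zariski open would have to die on a smaller one (the
route's support item `TorsionDiesGenerically`). [cite: BlochOgus1974ENS, (3.8)] -/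
theorem hodgeClassesGenericallyDivisible_of_nsmul_mem_coniveauFiltration_int
    ⦃p : ℕ⦄ ⦃X : SchemeOver ℂ⦄ (hX : IsSmoothProjective (2 * p) X)
    (z : singularCohomology ℤ ℤ (ComplexPoints X) (2 * p)) {N : ℕ}
    (hz : N • z ∈ coniveauFiltration ℤ X (2 * p) 1) {m : ℕ} (hm : m.Coprime N) :
    ∃ Z : Set X.left, IsClosed Z ∧ Z ≠ Set.univ ∧
      ∃ y : singularCohomology ℤ ℤ (complexPointsCompl X Z) (2 * p),
        m • y = singularCohomology.map ℤ ℤ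
          (⟨Subtype.val, continuous_subtype_val⟩ : C(complexPointsCompl X Z, ComplexPoints X))
          (2 * p) z := by
  haveI := IsSmoothProjective.isIntegral_holds hX
  obtain ⟨Z, hZ, hZne, h0⟩ :=
    (exists_ne_univ_restrictToCompl_eq_zero_iff_mem_coniveauFiltration_one ℤ (N • z)).2 hz
  set w := singularCohomology.map ℤ ℤ
    (⟨Subtype.val, continuous_subtype_val⟩ : C(complexPointsCompl X Z, ComplexPoints X)) (2 * p) z
    with hw
  have hNw : N • w = 0 := by
    rw [hw, ← map_nsmul]
    exact h0
  rcases Nat.lt_or_ge 1 N with hN | hN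
  · -- Bézout in `ℕ`: `m a = N q + 1`, so `m • (a • w) = q • (N • w) + w = w`
    obtain ⟨a, -, ha⟩ := Nat.exists_mul_mod_eq_one_of_coprime hm hN
    have hdm := Nat.div_add_mod (m * a) N
    rw [ha] at hdm
    refine ⟨Z, hZ, hZne, a • w, ?_⟩
    calc m • a • w = (m * a) • w := (mul_nsmul' w m a).symm
      _ = (N * (m * a / N) + 1) • w := by rw [hdm]
      _ = w := by rw [add_nsmul, one_nsmul, mul_nsmul, hNw, nsmul_zero, zero_add]
  · -- `N ≤ 1`: either `N = 0` (then `m = 1`) or `N = 1` (then `w = 0`)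
    interval_cases N
    · have hm1 : m = 1 := (Nat.coprime_zero_right m).1 hm
      exact ⟨Z, hZ, hZne, w, by rw [hm1, one_nsmul]⟩
    · rw [one_nsmul] at hNw
      exact ⟨Z, hZ, hZne, 0, by rw [nsmul_zero]; exact hNw.symm⟩

/-- **The divisor-ideal sector of C1, unconditionally.** For `X` a smooth projective complex
`2p`-fold and `z ∈ H²ᵖ(X(ℂ); ℤ)` in the `ℤ`-span of the cup products `D ⌣ w`, `w ⌣ D` with
`D ∈ H²(X(ℂ); ℤ)` of `(1,1)` complexification and `w` arbitrary and
every `m`, there are a proper Zariski-closed `Z` and `y` (namely `0`) on `(X ∖ Z)(ℂ)` with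
`m • y = z|_{(X ∖ Z)(ℂ)}`: the ideal of the integral `(1,1)`-classes lies in `N¹ H^*(X(ℂ); ℤ)`
(`span_cupProduct_oneOne_le_coniveauFiltration_one`, from the integral Lefschetz theorem on
`(1,1)`-classes). [cite: VoisinHodgeI2002, Thm. 11.30, Rem. 7.9, Thm. 11.33]
[cite: HatcherAT2002, Prop. 3.10] -/
theorem hodgeClassesGenericallyDivisible_of_mem_span_cupProduct_oneOne
    ⦃p : ℕ⦄ ⦃X : SchemeOver ℂ⦄ (hX : IsSmoothProjective (2 * p) X)
    (z : singularCohomology ℤ ℤ (ComplexPoints X) (2 * p))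
    (hz : z ∈ Submodule.span ℤ {x : singularCohomology ℤ ℤ (ComplexPoints X) (2 * p) |
          ∃ (q : ℕ) (D : singularCohomology ℤ ℤ (ComplexPoints X) 2)
            (w : singularCohomology ℤ ℤ (ComplexPoints X) q),
            IsOfHodgeType (2 * p) X 2 1 1
              (singularCohomology.ringChange (Int.castRingHom ℂ) (ComplexPoints X) 2 D) ∧
            ((∃ h : 2 + q = 2 * p, x = cupProduct h D w) ∨ (∃ h : q + 2 = 2 * p, x = cupProduct h w D))}) (m : ℕ) :
    ∃ Z : Set X.left, IsClosed Z ∧ Z ≠ Set.univ ∧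
      ∃ y : singularCohomology ℤ ℤ (complexPointsCompl X Z) (2 * p),
        m • y = singularCohomology.map ℤ ℤ
          (⟨Subtype.val, continuous_subtype_val⟩ : C(complexPointsCompl X Z, ComplexPoints X))
          (2 * p) z :=
  hodgeClassesGenericallyDivisible_of_mem_coniveauFiltration_int hX z
    (span_cupProduct_oneOne_le_coniveauFiltration_one hX (2 * p) hz) m

/-- **Registered sub-goal `stub_hodgeClassesGenericallyDivisible_divisorIdeal` of the crux item
stmt-HodgeConjecture-18466** — its divisor-ideal sector with NO further hypothesis: the item's
statement with "`z` in the `ℤ`-span of the `D ⌣ w`, `w ⌣ D`, `D` an integral `(1,1)`-class" in place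
of "`z ⊗ ℂ` of Hodge type `(p,p)`"; the proof is
`hodgeClassesGenericallyDivisible_of_mem_span_cupProduct_oneOne` (integral Lefschetz `(1,1)`
+ naturality of the cup product). [cite: VoisinHodgeI2002, Thm. 11.30, Rem. 7.9, Thm. 11.33]
[cite: HatcherAT2002, Prop. 3.10] -/
theorem stub_hodgeClassesGenericallyDivisible_divisorIdeal :
    ∀ ⦃p : ℕ⦄ ⦃X : SchemeOver ℂ⦄, 1 ≤ p → IsSmoothProjective (2 * p) X →
      ∀ z : singularCohomology ℤ ℤ (ComplexPoints X) (2 * p),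
        z ∈ Submodule.span ℤ {x : singularCohomology ℤ ℤ (ComplexPoints X) (2 * p) |
          ∃ (q : ℕ) (D : singularCohomology ℤ ℤ (ComplexPoints X) 2)
            (w : singularCohomology ℤ ℤ (ComplexPoints X) q),
            IsOfHodgeType (2 * p) X 2 1 1
              (singularCohomology.ringChange (Int.castRingHom ℂ) (ComplexPoints X) 2 D) ∧
            ((∃ h : 2 + q = 2 * p, x = cupProduct h D w) ∨ (∃ h : q + 2 = 2 * p, x = cupProduct h w D))} →
        ∀ m : ℕ, 1 ≤ m → ∃ Z : Set X.left, IsClosed Z ∧ Z ≠ Set.univ ∧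
          ∃ y : singularCohomology ℤ ℤ (complexPointsCompl X Z) (2 * p),
            m • y = singularCohomology.map ℤ ℤ
              (⟨Subtype.val, continuous_subtype_val⟩ : C(complexPointsCompl X Z, ComplexPoints X))
              (2 * p) z :=
  fun _ _ _ hX z hz m _ ↦ hodgeClassesGenericallyDivisible_of_mem_span_cupProduct_oneOne hX z hz m

end Summit.HodgeConjecture.HodgeConjecture.Theorems
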